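import Mathlib
import Summits.MatrixMultiplication.Statement
import Summits.MatrixMultiplication.MatrixMultiplication.Theorems.GraphEquationsPivotDesigns

/-!
# Growth of the corank dial: `CorankBound n c` forces `c ≥ n − 1` and `c ≥ n^{3/2}/4` (`GraphEquations`, M55)

Decomp-mm node «GraphEquations» (lens 5, g42); attacked leaf `MultiplicityReduction`
(stmt-MatrixMultiplication-27806).  Target VERBATIM: `_root_.MatrixMultiplication`.  Route-neutral.
Two instances of the pivot designs of M54 (`PivotDesign`, `not_corankBound`):
* the COMB `comb r₀` — one slot row `r₀` serving the diagonal pivots `(i,i)`, `i ≠ r₀` (`|P| = n − 1`):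
  `CorankBound.le_succ : CorankBound n c → n ≤ c + 1`;
* the BLOCKS `block m h` on `n = m·m` — rows and columns read as pairs `(u,s)`, `(y,z) ∈ [m]²`; pivots at
  rows `(u,s)`, `s < h`, columns `(s,z)`, `z ≥ h`, served by the slot row `(u,z)` (`|P| = m·h·(m−h)`):
  `not_corankBound_block`, and with `m = 2h`: `not_corankBound_sq : c < 2h³ → ¬ CorankBound (2h·2h) c`,
  i.e. `CorankBound n c → c ≥ n^{3/2}/4` on `n = 4h²` (`CorankBound.two_mul_cube_le`).
CONSEQUENCE (ask (2) of NODE-g41 DECIDED): `exists_not_corankBound_linear` / `not_eventually_corankBound_linear`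
— for every `C, n₀` some `n ≥ n₀` has `¬ CorankBound n (C·n)`: the LINEAR corank dial that was to feed
`CubicUnmask` (M53 docstring, critic l.2711 ask 1) is FALSE for every constant; corank-COUNTING cannot
bound the unmasking cost by `O(n²)`.  What survives is cost-relative / batch unmasking (NODE-g42 §3).
Sources: [BurgisserClausenShokrollahi1997, Problem 16.3]; the cell's M51a–M54.  No `sorry`.
-/

-- dupNamespace: forced by the nested Summit.MatrixMultiplication.MatrixMultiplication layout (D-0017)
set_option linter.dupNamespace false

noncomputable section

namespace Summit.MatrixMultiplication.MatrixMultiplication.Theorems.GraphEquations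

open Matrix

namespace PivotDesign

/-! ## The comb: `|P| = n − 1` -/

/-- The COMB design: slot row `r₀` serves the diagonal pivots `(i, i)`, `i ≠ r₀`. -/
def comb {n : ℕ} (r₀ : Fin n) : PivotDesign n where
  piv q := decide (q.1 = q.2 ∧ q.1 ≠ r₀)
  slot r := decide (r = r₀)
  srow _ := r₀
  slot_fst_eq_false q hq := by
    rw [decide_eq_true_eq] at hq
    exact decide_eq_false hq.2
  slot_srow q _ := decide_eq_true rfl
  cross q q' hq hq' _ hne := by
    rw [decide_eq_true_eq] at hq hq'
    rw [decide_eq_false_iff_not]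
    rintro ⟨h, -⟩
    exact hne (Prod.ext (h.trans hq.1.symm) (hq'.1.symm.trans h))

/-- **`CorankBound n c` forces `c ≥ n − 1`** (the comb has `n − 1` pivots). -/
theorem _root_.Summit.MatrixMultiplication.MatrixMultiplication.Theorems.GraphEquations.CorankBound.le_succ
    {n c : ℕ} (h : CorankBound n c) : n ≤ c + 1 := by
  by_contra hlt
  rw [not_le] at hlt
  have h0 : 0 < n := by omega
  refine (comb (⟨0, h0⟩ : Fin n)).not_corankBound ?_ h
  let ι : Fin (c + 1) → {q // (comb (⟨0, h0⟩ : Fin n)).piv q = true} := fun i =>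
    ⟨(⟨i.1 + 1, by omega⟩, ⟨i.1 + 1, by omega⟩), by simp [comb]⟩
  have hι : Function.Injective ι := by
    intro i j hij
    have := congrArg (fun x => x.1.1.1) hij
    exact Fin.ext (by simpa [ι] using this)
  simpa using Fintype.card_le_of_injective ι hι

/-! ## The blocks: `|P| = m·h·(m−h)` on `n = m·m` -/

/-- The BLOCK design on `n = m·m` with threshold `h`: a row `(u,s)` (read through `flat m`) is a slot row
iff `h ≤ s`; the pivots sit at rows `(u,s)`, `s < h`, columns `(s,z)`, `h ≤ z`, served by row `(u,z)`. -/
def block (m h : ℕ) : PivotDesign (m * m) where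
  piv q := decide ((((flat m).symm q.1).2 : ℕ) < h ∧ ((flat m).symm q.2).1 = ((flat m).symm q.1).2 ∧
    h ≤ (((flat m).symm q.2).2 : ℕ))
  slot r := decide (h ≤ (((flat m).symm r).2 : ℕ))
  srow q := flat m (((flat m).symm q.1).1, ((flat m).symm q.2).2)
  slot_fst_eq_false q hq := by
    rw [decide_eq_true_eq] at hq
    exact decide_eq_false (not_le.mpr hq.1)
  slot_srow q hq := by
    rw [decide_eq_true_eq] at hq
    simpa using hq.2.2
  cross q q' hq hq' hs hne := by
    rw [decide_eq_true_eq] at hq hq'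
    rw [decide_eq_false_iff_not]
    rintro ⟨-, hy, -⟩
    obtain ⟨hu, hz⟩ := Prod.mk.inj ((flat m).injective hs)
    have h1 : (flat m).symm q'.1 = (flat m).symm q.1 := Prod.ext hu (hy.symm.trans hq.2.1)
    have h2 : (flat m).symm q'.2 = (flat m).symm q.2 :=
      Prod.ext (by rw [hq'.2.1, hq.2.1]; exact congrArg Prod.snd h1) hz
    exact hne (Prod.ext ((flat m).symm.injective h1) ((flat m).symm.injective h2))

/-- The block design has at least `m·h·(m−h)` pivots (`h ≤ m`). -/
theorem block_card {m h : ℕ} (hhm : h ≤ m) :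
    m * h * (m - h) ≤ Fintype.card {q // (block m h).piv q = true} := by
  let ι : Fin m × Fin h × Fin (m - h) → {q // (block m h).piv q = true} := fun x =>
    ⟨(flat m (x.1, ⟨x.2.1.1, lt_of_lt_of_le x.2.1.2 hhm⟩),
      flat m (⟨x.2.1.1, lt_of_lt_of_le x.2.1.2 hhm⟩, ⟨h + x.2.2.1, by omega⟩)), by
      simp [block]⟩
  have hι : Function.Injective ι := by
    rintro ⟨u, s, z⟩ ⟨u', s', z'⟩ hij
    have h12 := congrArg (fun x => ((flat m).symm x.1.1, (flat m).symm x.1.2)) hij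
    simp only [ι, Equiv.symm_apply_apply, Prod.mk.injEq, Fin.mk.injEq] at h12
    obtain ⟨⟨hu, hs⟩, -, hz⟩ := h12
    subst hu
    have hs' : s = s' := Fin.ext hs
    have hz' : z = z' := Fin.ext (by omega)
    subst hs' hz'
    rfl
  simpa [Fintype.card_prod, Fintype.card_fin, mul_assoc] using Fintype.card_le_of_injective ι hι

/-- **Blocks**: `¬ CorankBound (m·m) c` for every `c < m·h·(m−h)` (`h ≤ m`). -/
theorem not_corankBound_block {m h c : ℕ} (hhm : h ≤ m) (hc : c < m * h * (m - h)) :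
    ¬ CorankBound (m * m) c :=
  (block m h).not_corankBound (hc.trans_le (block_card hhm))

/-- **Square-root law**: with `m = 2h`, `¬ CorankBound (2h·2h) c` for every `c < 2h³ = n^{3/2}/4`. -/
theorem not_corankBound_sq (h : ℕ) {c : ℕ} (hc : c < 2 * h * h * h) : ¬ CorankBound (2 * h * (2 * h)) c :=
  not_corankBound_block (m := 2 * h) (h := h) (by omega) (by
    have h2 : 2 * h - h = h := by omega
    rw [h2]; exact hc)

end PivotDesign

/-- Contrapositive of the square-root law: `CorankBound (4h²) c → 2h³ ≤ c`. -/
theorem CorankBound.two_mul_cube_le {h c : ℕ} (hcb : CorankBound (2 * h * (2 * h)) c) :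
    2 * h * h * h ≤ c :=
  not_lt.mp fun hc => PivotDesign.not_corankBound_sq h hc hcb

/-- **The linear corank dial is false for every constant**: for all `C, n₀` there is `n ≥ n₀` with
`¬ CorankBound n (C·n)` (take `n = 4h²` with `h > 2C`). -/
theorem exists_not_corankBound_linear (C n₀ : ℕ) : ∃ n, n₀ ≤ n ∧ ¬ CorankBound n (C * n) := by
  refine ⟨2 * (2 * C + 1 + n₀) * (2 * (2 * C + 1 + n₀)), ?_, PivotDesign.not_corankBound_sq _ ?_⟩
  · nlinarith
  · set h := 2 * C + 1 + n₀ with hh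
    have hC : 2 * C < h := by omega
    have hpos : 0 < 2 * h * h := by positivity
    calc C * (2 * h * (2 * h)) = (2 * C) * (2 * h * h) := by ring
      _ < h * (2 * h * h) := Nat.mul_lt_mul_of_pos_right hC hpos
      _ = 2 * h * h * h := by ring

/-- Packaged: there is NO pair `(C, n₀)` with `CorankBound n (C·n)` for all `n ≥ n₀`. -/
theorem not_eventually_corankBound_linear : ¬ ∃ C n₀ : ℕ, ∀ n, n₀ ≤ n → CorankBound n (C * n) := by
  rintro ⟨C, n₀, hC⟩
  obtain ⟨n, hn, hnot⟩ := exists_not_corankBound_linear C n₀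
  exact hnot (hC n hn)

/-- In particular the global form `∀ n, CorankBound n (C·n)` fails for every `C`. -/
theorem not_forall_corankBound_linear (C : ℕ) : ¬ ∀ n, CorankBound n (C * n) := fun h =>
  not_eventually_corankBound_linear ⟨C, 0, fun n _ => h n⟩

end Summit.MatrixMultiplication.MatrixMultiplication.Theorems.GraphEquations

end
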